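import Mathlib
import HarnessLib
import Summits.NavierStokesRegularity.NavierStokesRegularity.Theses.QuarterLogPincer
import Summits.NavierStokesRegularity.NavierStokesRegularity.Theorems.QuarterLogPincerThinCascadeDefs
import Summits.NavierStokesRegularity.NavierStokesRegularity.Theorems.QuarterLogPincerTypeIQuantSubcubicExpLiouvilleTransfer
import Summits.NavierStokesRegularity.NavierStokesRegularity.Theorems.QuarterLogPincerTypeIQuantSubcubicExpZoomLimit
import Summits.NavierStokesRegularity.NavierStokesRegularity.Theorems.QuarterLogPincerTypeIQuantSubcubicExpZoomClass
import Summits.NavierStokesRegularity.NavierStokesRegularity.Theorems.QuarterLogPincerTypeIQuantSubcubicExpZoomSingular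
import Summits.NavierStokesRegularity.NavierStokesRegularity.Theorems.QuarterLogPincerTypeIQuantSubcubicExpZoomBlowup
import Summits.NavierStokesRegularity.NavierStokesRegularity.Theorems.QuarterLogPincerTypeIQuantSubcubicExpZoomTypeIBoundC
import Summits.NavierStokesRegularity.NavierStokesRegularity.Theorems.TypeIQuarterGateScarEnvelopeTypeIBudgetCompactnessEventual
import Summits.NavierStokesRegularity.NavierStokesRegularity.Theorems.TypeIQuarterGateScarEnvelopeTypeISatelliteTowerDefs
import Summits.NavierStokesRegularity.NavierStokesRegularity.Theorems.TypeIQuarterGateScarEnvelopeTypeISatelliteTowerEnvelopeDefs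
import Summits.NavierStokesRegularity.NavierStokesRegularity.Theorems.TypeIQuarterGateScarEnvelopeTypeISatelliteTowerEnvelopeLeaves
import Literature.Analysis.FluidPDE.SuitableWeakCongr
import Summits.NavierStokesRegularity.NavierStokesRegularity.Theorems.TypeIQuarterGateScarEnvelopeTypeISatelliteTowerAttainment
import Literature.Analysis.FluidPDE.LocalTypeICongr
import Literature.Analysis.FluidPDE.ESSLocalHolderBlowupLimit


/-!
# Route `QuarterLogPincer`, crux `TypeIQuantSubcubicExp` (stmt-NavierStokesRegularity-24077), line `ab_root` — part 1/2:
# CASCADE ROOTING (S1), the A–B TRANSFER (S2) and the THIN-AND-ROOTED zoom limit (S1⁺)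

Tree copy (part 1 of 2, split only for the 400-line rule) of the files-only seat ns-idea-7 g8's line
`Cruxes/TypeIQuantSubcubicExp/Lines/ab_root.lean` v2 (sha12 533ab3821881; idea-crit-4 PASS 19:07:36Z /
19:13:03Z 2026-08-28, typed audit ns-afl-r1 g9 19:34:03Z: 0 sorry, pure edges), landed verbatim by the
pub-ns-dss typer (g35) at the critic's seconded ask.  The one deviation from verbatim: the folklore
restatement `not_regPt_zero_of_isBackwardSingularPoint'` is replaced by the landed tree theorem
`…Cruxes.ScarEnvelopeTypeI.ZoomDictionary.not_regPt_zero_of_isBackwardSingularPoint`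
(`…SatelliteTowerAttainment`, gate rule `dedup.landed`), and the slab-cover lemma is inlined.
Part 2 (`…ABRoot.lean`) carries the EDGES (`typeIQuantSubcubicExp_of_typeILiouvilleAB`,
`…_of_envelopedExclusions`, `…_of_thinTowerLiouville`, the object forms) and the author's full line docstring.

LEFT-EDGE LINE (calibration polarity): the Liouville CORE of sub-route H3 / crux 23843, `TypeILiouvilleAB`
(tree `…SatelliteTowerEnvelopeDefs`), IMPLIES the crux 24077.  THE MOVE («rooting»): run the thin-cascade
zoom of 24077 (`exists_typeIAncientMild_zoomLimit_of_cheapCascades`) through the 23843 eventual compactness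
engine `local_typeI_compactness_twin_inBall_evt` with the PROVED uniform Albritton–Barker bound of the zooms
`exists_typeIBound_zoom_le` (4th stub `UniformScaledEnergy`, I1), and identify the engine's `L³_loc` limit
a.e. with the KNSS limit `W`; the a.e.-invariance of every clause of `ABTower`
(`IsSuitableWeakSolutionInBall.congr_ae'`, `HasWeakSpatialGradientOn.congr_ae`, `typeIBound_congr_ae`,
`isBackwardSingularPoint_of_ae_eq`) makes `W` itself an `ABTower M W P H` with a backward singular origin.

Content of this part (ALL KERNEL-CHECKED, no stub):
* line objects `CascadeTwinLimit`, `CascadeRooting`, `ABTransfer`;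
* (S2) `abTransfer : ABTransfer`;
* (S1) `cascadeTwinLimit_of_zoomData`, `cascadeRooting : CascadeRooting`;
* (S1⁺) `exists_thinObject_and_cascadeTwinLimit_of_cheapCascades` — the SAME KNSS limit is the THIN OBJECT of
  line `thin_cascade` (`ThinObject M q W g`) AND rooted in the A–B class.

No summit is proved: 24077, 23843, (L′) = `TypeILiouvilleAB`, (E1⁺), (E2), the DSS wall and Navier–Stokes
regularity are OPEN.  bears_on: LADDER-NS W7 (24077) / H3 (23843).
-/
noncomputable section

set_option linter.dupNamespace false

namespace Summit.NavierStokesRegularity.NavierStokesRegularity.Cruxes.TypeIQuantSubcubicExp.AbRoot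

open MeasureTheory Set Function Filter Topology Metric
open scoped ENNReal NNReal InnerProductSpace RealInnerProductSpace
open Literature.Analysis Literature.Analysis.FluidPDE
open Summit.NavierStokesRegularity.NavierStokesRegularity.Cruxes.TypeIQuantSubcubicExp.ThinCascade
open Summit.NavierStokesRegularity.NavierStokesRegularity.Theorems.ThinCascade
open Summit.NavierStokesRegularity.NavierStokesRegularity.Cruxes.ScarEnvelopeTypeI.ZoomDictionary
open Summit.NavierStokesRegularity.NavierStokesRegularity.Cruxes.ScarEnvelopeTypeI.SliceBudget
  (local_typeI_compactness_twin_inBall_evt)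

/-! ### The line objects -/

/-- **CASCADE TWIN-LIMIT data** at Type-I constant `M`: a KNSS zoom limit `W` (`IsTypeIAncientMild M W`)
together with an Albritton–Barker engine limit `(U, P, H)` — in the class `IsSuitableWeakSolutionInBall R 0`
on every ball, suitable on the open backward slab with weak gradient `H` and `𝐈(U, P, H) < ∞` — which
agrees with `W` a.e. on every backward cylinder `Q(0, R)` and has a backward singular point at the
space–time origin. [this file; line object] -/
def CascadeTwinLimit (M : ℝ) (W U : ℝ → EuclideanSpace ℝ (Fin 3) → EuclideanSpace ℝ (Fin 3))
    (P : ℝ → EuclideanSpace ℝ (Fin 3) → ℝ)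
    (H : ℝ → EuclideanSpace ℝ (Fin 3) → EuclideanSpace ℝ (Fin 3) →L[ℝ] EuclideanSpace ℝ (Fin 3)) : Prop :=
  IsTypeIAncientMild M W ∧
  (∀ R : ℝ, 0 < R → IsSuitableWeakSolutionInBall R (0 : ℝ × EuclideanSpace ℝ (Fin 3)) U P) ∧
  IsSuitableWeakSolutionOn (slab (EuclideanSpace ℝ (Fin 3)) (Iio 0) isOpen_Iio) 1 0 U P ∧
  HasWeakSpatialGradientOn (slab (EuclideanSpace ℝ (Fin 3)) (Iio 0) isOpen_Iio) U H ∧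
  typeIBound (Iio (0 : ℝ) ×ˢ univ) U P H < ⊤ ∧
  (∀ R : ℝ, 0 < R → uncurry U =ᵐ[volume.restrict
      (parabolicCylinder R (0 : ℝ × EuclideanSpace ℝ (Fin 3)))] uncurry W) ∧
  IsBackwardSingularPoint U (0 : ℝ × EuclideanSpace ℝ (Fin 3))

/-- (S1) **CASCADE ROOTING**: cheap cascades of every length `K` at `(M, q)`, `q > 0`, produce cascade
twin-limit data at `M`. PROVED below (`cascadeRooting`). [this file; line object] -/
def CascadeRooting : Prop :=
  ∀ (M q : ℝ), 0 < q → (∀ K : ℕ, CheapCascade M q K) →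
    ∃ (W U : ℝ → EuclideanSpace ℝ (Fin 3) → EuclideanSpace ℝ (Fin 3))
      (P : ℝ → EuclideanSpace ℝ (Fin 3) → ℝ)
      (H : ℝ → EuclideanSpace ℝ (Fin 3) → EuclideanSpace ℝ (Fin 3) →L[ℝ] EuclideanSpace ℝ (Fin 3)),
      CascadeTwinLimit M W U P H

/-- (S2) **A–B TRANSFER**: cascade twin-limit data make the KNSS limit `W` a Type-I ancient mild tower of
Albritton–Barker's class (with the engine's pressure and gradient) which is NOT regular at the origin.
PROVED below (`abTransfer`). [this file; line object] -/
def ABTransfer : Prop :=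
  ∀ (M : ℝ) (W U : ℝ → EuclideanSpace ℝ (Fin 3) → EuclideanSpace ℝ (Fin 3))
    (P : ℝ → EuclideanSpace ℝ (Fin 3) → ℝ)
    (H : ℝ → EuclideanSpace ℝ (Fin 3) → EuclideanSpace ℝ (Fin 3) →L[ℝ] EuclideanSpace ℝ (Fin 3)),
    CascadeTwinLimit M W U P H → ABTower M W P H ∧ ¬ RegPt W 0

/-! ### (S2) The A–B transfer (a.e.-invariance of every clause of `ABTower`) -/

/-- a.e. agreement on every `Q(0, R)` gives a.e. agreement on the open backward slab (the slab is
covered by the cylinders `Q(0, n+1)`). [folklore] -/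
theorem ae_eq_slab_of_ae_eq_cylinders
    {U W : ℝ → EuclideanSpace ℝ (Fin 3) → EuclideanSpace ℝ (Fin 3)}
    (hae : ∀ R : ℝ, 0 < R → uncurry U =ᵐ[volume.restrict
      (parabolicCylinder R (0 : ℝ × EuclideanSpace ℝ (Fin 3)))] uncurry W) :
    ∀ᵐ z ∂(volume.restrict (Iio (0 : ℝ) ×ˢ (univ : Set (EuclideanSpace ℝ (Fin 3))))),
      uncurry U z = uncurry W z := by
  have hcover : Iio (0 : ℝ) ×ˢ (univ : Set (EuclideanSpace ℝ (Fin 3))) ⊆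
      ⋃ n : ℕ, parabolicCylinder ((n : ℝ) + 1) (0 : ℝ × EuclideanSpace ℝ (Fin 3)) := by
    rintro ⟨t, x⟩ ⟨ht, -⟩
    obtain ⟨n, hn⟩ := exists_nat_gt (max (Real.sqrt (-t)) ‖x‖)
    refine mem_iUnion.2 ⟨n, ?_⟩
    rw [mem_parabolicCylinder]
    have h1 : Real.sqrt (-t) < (n : ℝ) + 1 := by
      linarith [le_max_left (Real.sqrt (-t)) ‖x‖]
    have h2 : -t < ((n : ℝ) + 1) ^ 2 := by
      have h0 : 0 ≤ -t := by simp only [mem_Iio] at ht; linarith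
      nlinarith [Real.sq_sqrt h0, Real.sqrt_nonneg (-t)]
    refine ⟨⟨?_, ?_⟩, ?_⟩
    · simp only [Prod.fst_zero]; linarith
    · simpa using ht
    · simp only [Prod.snd_zero, dist_zero_right]
      linarith [le_max_right (Real.sqrt (-t)) ‖x‖]
  have hU : ∀ᵐ z ∂(volume.restrict
      (⋃ n : ℕ, parabolicCylinder ((n : ℝ) + 1) (0 : ℝ × EuclideanSpace ℝ (Fin 3)))),
      uncurry U z = uncurry W z := by
    rw [ae_restrict_iUnion_iff]
    intro n
    exact hae _ (by positivity)
  exact ae_restrict_of_ae_restrict_of_subset hcover hU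


/-- (S2) **The A–B transfer, PROVED.**  Every clause of `ABTower` sees the velocity through integrals
(`IsSuitableWeakSolutionInBall.congr_ae'`, `HasWeakSpatialGradientOn.congr_ae`, `typeIBound_congr_ae`),
the KNSS limit carries `IsTypeIAncientMild` itself, and essential unboundedness at the origin passes
along a.e. equality (`isBackwardSingularPoint_of_ae_eq`). [this file; line theorem] -/
theorem abTransfer : ABTransfer := by
  intro M W U P H hT
  obtain ⟨hW, hball, -, hwg, hI, hae, hsing⟩ := hT
  have hslab := ae_eq_slab_of_ae_eq_cylinders hae
  have hPP : ∀ (μ : Measure (ℝ × EuclideanSpace ℝ (Fin 3))), ∀ᵐ z ∂μ, uncurry P z = uncurry P z :=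
    fun μ => Eventually.of_forall fun _ => rfl
  refine ⟨⟨hW, fun a ha => (hball a ha).congr_ae' (hae a ha) (hPP _), hwg.congr_ae hslab, ?_⟩, ?_⟩
  · rw [← typeIBound_congr_ae hslab]
    exact hI
  · exact not_regPt_zero_of_isBackwardSingularPoint (isBackwardSingularPoint_of_ae_eq hae hsing)

/-! ### (S1) Cascade rooting (the thin-cascade zoom run through the 23843 engine) -/

/-- (S1, data form) **Rooting of a given zoom limit.**  For cascade frame data `hdata` (the
conclusion shape of `exists_typeIAncientMild_zoomLimit_of_cheapCascades`), a subsequence `φ` and ITS KNSS limit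
`W` (pointwise limit on the open past), the 23843 engine run along `φ` produces `(U, P, H)` with
`CascadeTwinLimit M W U P H`.  The zooms along `φ` are in the A–B class on `Q(0,2ᵐ)`, `m ≤ j`
(`zoom_isSuitableWeakSolutionInBall`, `zoom_isClassicalNSSolutionOnRegion`) with `𝐈 ≤ I < ∞` uniformly
(`exists_typeIBound_zoom_le`, i.e. the proved 4th stub `UniformScaledEnergy`); the EVENTUAL engine
`local_typeI_compactness_twin_inBall_evt` extracts `(U, P, H)` in the class on every ball and on the slab with
`𝐈 ≤ I`; the zooms blow up at the origin along every subsequence (`limsup_eLpNorm_top_zoom_eq_top`), so the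
origin is backward singular for `U`; and `U = W` a.e. on every `Q(0,R)` (a.e.-convergent sub-subsequence of
the `L³`-convergent one, uniqueness of limits). [this file; line theorem] -/
theorem cascadeTwinLimit_of_zoomData {M q : ℝ} {T τ ρ : ℕ → ℝ}
    {x₀ : ℕ → EuclideanSpace ℝ (Fin 3)}
    {u : ℕ → ℝ → EuclideanSpace ℝ (Fin 3) → EuclideanSpace ℝ (Fin 3)}
    {p : ℕ → ℝ → EuclideanSpace ℝ (Fin 3) → ℝ}
    (hdata : ∀ K : ℕ, TaoFrame (T K) (u K) (p K) ∧ 0 < τ K ∧ 0 < ρ K ∧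
        Real.exp (2 * K) * ρ K ^ 2 ≤ T K ∧
        τ K ≤ M ^ 2 * Real.exp (-2 * (K : ℝ)) * ρ K ^ 2 ∧
        (∀ t ∈ Icc 0 (T K), ∀ x : EuclideanSpace ℝ (Fin 3),
          ‖u K t x‖ ≤ M * (T K + τ K - t) ^ (-(1 / 2 : ℝ))) ∧
        Real.exp K ≤ ρ K * ‖u K (T K) (x₀ K)‖ ∧
        ∀ j : ℕ, 1 ≤ j → j ≤ K →
          ∫⁻ x in {x : EuclideanSpace ℝ (Fin 3) | ρ K < ‖x - x₀ K‖ ∧ ‖x - x₀ K‖ < Real.exp j * ρ K},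
              ENNReal.ofReal (‖u K (T K) x‖ ^ 3) ≤ ENNReal.ofReal (q * j))
    {φ : ℕ → ℕ} (hφ : StrictMono φ) {W : ℝ → EuclideanSpace ℝ (Fin 3) → EuclideanSpace ℝ (Fin 3)}
    (hW : IsTypeIAncientMild M W)
    (hpt : ∀ t < 0, ∀ x, Tendsto
      (fun j => ((ρ (φ j)) • stPull (ρ (φ j) ^ 2) (ρ (φ j)) (T (φ j)) (x₀ (φ j)) (u (φ j))) t x)
      atTop (𝓝 (W t x))) :
    ∃ (U : ℝ → EuclideanSpace ℝ (Fin 3) → EuclideanSpace ℝ (Fin 3))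
      (P : ℝ → EuclideanSpace ℝ (Fin 3) → ℝ)
      (H : ℝ → EuclideanSpace ℝ (Fin 3) → EuclideanSpace ℝ (Fin 3) →L[ℝ] EuclideanSpace ℝ (Fin 3)),
      CascadeTwinLimit M W U P H := by
  obtain ⟨I, hI, hbdM⟩ := exists_typeIBound_zoom_le M
  -- the zoom family along `φ`
  set v : ℕ → ℝ → EuclideanSpace ℝ (Fin 3) → EuclideanSpace ℝ (Fin 3) :=
    fun j => (ρ (φ j)) • stPull (ρ (φ j) ^ 2) (ρ (φ j)) (T (φ j)) (x₀ (φ j)) (u (φ j)) with hv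
  set qz : ℕ → ℝ → EuclideanSpace ℝ (Fin 3) → ℝ :=
    fun j => (ρ (φ j)) ^ 2 • stPull (ρ (φ j) ^ 2) (ρ (φ j)) (T (φ j)) (x₀ (φ j)) (p (φ j)) with hqz
  set G : ℕ → ℝ → EuclideanSpace ℝ (Fin 3) →
      EuclideanSpace ℝ (Fin 3) →L[ℝ] EuclideanSpace ℝ (Fin 3) :=
    fun j t x => fderiv ℝ (v j t) x with hG
  have hcl : ∀ K, IsClassicalNSSolutionOn (Icc 0 (T K)) 1 0 (u K) (p K) := fun K => (hdata K).1.1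
  have hρ : ∀ K, 0 < ρ K := fun K => (hdata K).2.2.1
  have hlife : ∀ K : ℕ, Real.exp (2 * K) * ρ K ^ 2 ≤ T K := fun K => (hdata K).2.2.2.1
  have hcentre : ∀ K : ℕ, Real.exp K ≤ ρ K * ‖u K (T K) (x₀ K)‖ :=
    fun K => (hdata K).2.2.2.2.2.2.1
  have hmφ : ∀ m j : ℕ, m ≤ j → m ≤ φ j := fun m j h => h.trans (hφ.id_le j)
  have hreg : ∀ m j : ℕ, m ≤ j → IsClassicalNSSolutionOnRegion
      (parabolicCylinder ((2 : ℝ) ^ m) (0 : ℝ × EuclideanSpace ℝ (Fin 3))) 1 0 (v j) (qz j) :=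
    fun m j h => zoom_isClassicalNSSolutionOnRegion (x₀ (φ j)) (hcl _) (hρ _) (hlife _) (hmφ m j h)
  have hball : ∀ m j : ℕ, m ≤ j → IsSuitableWeakSolutionInBall ((2 : ℝ) ^ m) 0 (v j) (qz j) :=
    fun m j h => zoom_isSuitableWeakSolutionInBall (x₀ (φ j)) (hcl _) (hρ _) (hlife _) (hmφ m j h)
  have hwg : ∀ m j : ℕ, m ≤ j → HasWeakSpatialGradientOn
      (parabolicCylinderOpens ((2 : ℝ) ^ m) (0 : ℝ × EuclideanSpace ℝ (Fin 3))) (v j) (G j) :=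
    fun m j h => (hreg m j h).hasWeakSpatialGradientOn (isOpen_parabolicCylinder _ _) subset_rfl
  have hbd : ∀ m j : ℕ, m ≤ j →
      typeIBound (parabolicCylinder ((2 : ℝ) ^ m) (0 : ℝ × EuclideanSpace ℝ (Fin 3)))
        (v j) (qz j) (G j) ≤ I :=
    fun m j hmj => hbdM (x₀ (φ j)) (hdata (φ j)).1 (hdata (φ j)).2.1 (hdata (φ j)).2.2.1
      (hdata (φ j)).2.2.2.1 (hdata (φ j)).2.2.2.2.2.1 (hmj.trans (hφ.id_le j))
  obtain ⟨U, P, H, σ, hσ, hInBall, hsw, hHU, hIU, hL3, hconv, hsing⟩ :=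
    local_typeI_compactness_twin_inBall_evt I v qz G hI hball hwg hbd
  -- `𝐈(U, P, H) ≤ I < ∞` by the eventual clause
  have hIU' : typeIBound (Iio (0 : ℝ) ×ˢ univ) U P H < ⊤ :=
    lt_of_le_of_lt (hIU I (Eventually.of_forall fun k m hmk => hbd m k hmk)) hI
  -- the origin is a backward singular point of `U`: the zooms blow up along `φ ∘ σ`
  have hUsing : IsBackwardSingularPoint U (0 : ℝ × EuclideanSpace ℝ (Fin 3)) :=
    hsing 0 (by simp) fun R hR =>
      limsup_eLpNorm_top_zoom_eq_top hcl hρ hlife hcentre (hφ.comp hσ) hR.1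
  -- `U = W` a.e. on every `Q(0, R)`
  have hae : ∀ R : ℝ, 0 < R → uncurry U =ᵐ[volume.restrict
      (parabolicCylinder R (0 : ℝ × EuclideanSpace ℝ (Fin 3)))] uncurry W := by
    intro R hR
    set Q : Set (ℝ × EuclideanSpace ℝ (Fin 3)) :=
      parabolicCylinder R (0 : ℝ × EuclideanSpace ℝ (Fin 3)) with hQ
    have hQmeas : MeasurableSet Q := (isOpen_parabolicCylinder _ _).measurableSet
    obtain ⟨m₀, hm₀⟩ := pow_unbounded_of_one_lt R (by norm_num : (1 : ℝ) < 2)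
    have hQsub : Q ⊆ parabolicCylinder ((2 : ℝ) ^ m₀) (0 : ℝ × EuclideanSpace ℝ (Fin 3)) :=
      parabolicCylinder_mono_radius hm₀.le hR.le _
    have hmeas : ∀ n : ℕ, AEStronglyMeasurable (uncurry (v (σ (n + m₀)))) (volume.restrict Q) := by
      intro n
      have hle : m₀ ≤ σ (n + m₀) := (Nat.le_add_left m₀ n).trans (hσ.id_le _)
      exact ((hreg m₀ _ hle).smooth_velocity.continuousOn.mono hQsub).aestronglyMeasurable hQmeas
    have hUmeas : AEStronglyMeasurable (uncurry U) (volume.restrict Q) :=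
      (hL3 R hR).aestronglyMeasurable
    have hconv' : Tendsto (fun n => eLpNorm (uncurry (v (σ (n + m₀))) - uncurry U) 3
        (volume.restrict Q)) atTop (𝓝 0) :=
      (hconv R hR).comp (tendsto_add_atTop_nat m₀)
    obtain ⟨ns, hns, hlim⟩ :=
      (tendstoInMeasure_of_tendsto_eLpNorm (by norm_num) hmeas hUmeas hconv').exists_seq_tendsto_ae
    have hidx : Tendsto (fun i => σ (ns i + m₀)) atTop atTop :=
      hσ.tendsto_atTop.comp ((tendsto_add_atTop_nat m₀).comp hns.tendsto_atTop)
    filter_upwards [hlim, ae_restrict_mem hQmeas] with z h1 h2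
    have ht : z.1 < 0 := by
      rw [hQ, mem_parabolicCylinder] at h2
      simpa using h2.1.2
    have h3 : Tendsto (fun i => uncurry (v (σ (ns i + m₀))) z) atTop (𝓝 (uncurry W z)) :=
      (hpt z.1 ht z.2).comp hidx
    exact tendsto_nhds_unique h1 h3
  exact ⟨U, P, H, hW, hInBall, hsw, hHU, hIU', hae, hUsing⟩

/-- (S1) **Cascade rooting, PROVED**: `exists_typeIAncientMild_zoomLimit_of_cheapCascades` +
`cascadeTwinLimit_of_zoomData`. [this file; line theorem] -/
theorem cascadeRooting : CascadeRooting := by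
  intro M q hq hK
  obtain ⟨T, τ, ρ, x₀, u, p, φ, W, hdata, hφ, hW, -, hpt, -⟩ :=
    exists_typeIAncientMild_zoomLimit_of_cheapCascades hK
  obtain ⟨U, P, H, hT⟩ := cascadeTwinLimit_of_zoomData hdata hφ hW hpt
  exact ⟨W, U, P, H, hT⟩

/-! ### (S1⁺) The SAME zoom limit is the thin object of line `thin_cascade` -/

/-- (S1⁺) **Thin AND rooted, PROVED.**  Cheap cascades of every length at `(M, q)`, `q > 0`, produce ONE KNSS
limit `W` which is simultaneously the THIN OBJECT of line `thin_cascade` (`ThinObject M q W g`, verbatim the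
landed assembly `exists_thinObject_of_cheapCascades`: uniform local energy, `SingularAt W 0`, weak final trace
`g` with the log-thin annular budget) AND rooted in Albritton–Barker's class (`CascadeTwinLimit M W U P H`).
[this file; line theorem] -/
theorem exists_thinObject_and_cascadeTwinLimit_of_cheapCascades {M q : ℝ} (hq : 0 < q)
    (hK : ∀ K : ℕ, CheapCascade M q K) :
    ∃ (W : ℝ → EuclideanSpace ℝ (Fin 3) → EuclideanSpace ℝ (Fin 3))
      (g : EuclideanSpace ℝ (Fin 3) → EuclideanSpace ℝ (Fin 3))
      (U : ℝ → EuclideanSpace ℝ (Fin 3) → EuclideanSpace ℝ (Fin 3))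
      (P : ℝ → EuclideanSpace ℝ (Fin 3) → ℝ)
      (H : ℝ → EuclideanSpace ℝ (Fin 3) → EuclideanSpace ℝ (Fin 3) →L[ℝ] EuclideanSpace ℝ (Fin 3)),
      ThinObject M q W g ∧ CascadeTwinLimit M W U P H := by
  -- (1) the zoom limit
  obtain ⟨T, τ, ρ, x₀, u, p, φ, W, hdata, hφ, hTI, -, hpt, -⟩ :=
    exists_typeIAncientMild_zoomLimit_of_cheapCascades hK
  -- the rooting of THIS `W`
  obtain ⟨U, P, H, hT⟩ := cascadeTwinLimit_of_zoomData hdata hφ hTI hpt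
  -- (4) the trace along a further subsequence (verbatim `exists_thinObject_of_cheapCascades`)
  obtain ⟨ψ, g, hψ, hgli, hg2, hgw⟩ := exists_traceLimit_of_cheapCascades hdata hφ
  have hφψ : StrictMono (φ ∘ ψ) := hφ.comp hψ
  have hpt' : ∀ t < 0, ∀ x, Tendsto
      (fun j => ((ρ ((φ ∘ ψ) j)) • stPull (ρ ((φ ∘ ψ) j) ^ 2) (ρ ((φ ∘ ψ) j)) (T ((φ ∘ ψ) j))
        (x₀ ((φ ∘ ψ) j)) (u ((φ ∘ ψ) j))) t x) atTop (𝓝 (W t x)) :=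
    fun t ht x => (hpt t ht x).comp hψ.tendsto_atTop
  have hgw' : ∀ (ζ : EuclideanSpace ℝ (Fin 3) → EuclideanSpace ℝ (Fin 3)), MemLp ζ 2 volume →
      ∀ (a : ℝ), (∀ y, y ∉ ball (0 : EuclideanSpace ℝ (Fin 3)) a → ζ y = 0) →
      Tendsto (fun k => ∫ y, ⟪((ρ ((φ ∘ ψ) k)) • stPull (ρ ((φ ∘ ψ) k) ^ 2) (ρ ((φ ∘ ψ) k))
        (T ((φ ∘ ψ) k)) (x₀ ((φ ∘ ψ) k)) (u ((φ ∘ ψ) k))) 0 y, ζ y⟫) atTop (𝓝 (∫ y, ⟪g y, ζ y⟫)) :=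
    hgw
  refine ⟨W, g, U, P, H, ⟨hTI, uniformLocalEnergy_zoomLimit_of_cheapCascades hdata hφ hpt,
    singularAt_zoomLimit_of_cheapCascades hdata hφ hpt, hgli,
    tendsto_pairing_zoomLimit_of_cheapCascades hdata hφψ hpt' hgw', ?_⟩, hT⟩
  -- (6) the annular budget of the trace
  have hVc : ∀ k, Continuous (((ρ ((φ ∘ ψ) k)) • stPull (ρ ((φ ∘ ψ) k) ^ 2) (ρ ((φ ∘ ψ) k))
      (T ((φ ∘ ψ) k)) (x₀ ((φ ∘ ψ) k)) (u ((φ ∘ ψ) k))) 0) := by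
    intro k
    have hcl := (hdata ((φ ∘ ψ) k)).1.1
    have hT : T ((φ ∘ ψ) k) ∈ Icc 0 (T ((φ ∘ ψ) k)) :=
      ⟨le_trans (by positivity) (hdata ((φ ∘ ψ) k)).2.2.2.1, le_rfl⟩
    have huc : Continuous (u ((φ ∘ ψ) k) (T ((φ ∘ ψ) k))) := (hcl.contDiff_velocity hT).continuous
    have e : ((ρ ((φ ∘ ψ) k)) • stPull (ρ ((φ ∘ ψ) k) ^ 2) (ρ ((φ ∘ ψ) k)) (T ((φ ∘ ψ) k))
        (x₀ ((φ ∘ ψ) k)) (u ((φ ∘ ψ) k))) 0 = fun y => (ρ ((φ ∘ ψ) k)) •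
          u ((φ ∘ ψ) k) (T ((φ ∘ ψ) k) + ρ ((φ ∘ ψ) k) ^ 2 * 0)
            (x₀ ((φ ∘ ψ) k) + (ρ ((φ ∘ ψ) k)) • y) := by
      funext y; simp only [smul_stPull_apply]
    rw [e, mul_zero, add_zero]
    have hlin : Continuous fun y : EuclideanSpace ℝ (Fin 3) => x₀ ((φ ∘ ψ) k) + (ρ ((φ ∘ ψ) k)) • y :=
      continuous_const.add (continuous_id.const_smul (ρ ((φ ∘ ψ) k)))
    exact (huc.comp hlin).const_smul (ρ ((φ ∘ ψ) k))
  have hbudget : ∀ j : ℕ, 1 ≤ j → ∀ᶠ k in atTop,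
      ∫⁻ y in {y : EuclideanSpace ℝ (Fin 3) | 1 < ‖y‖ ∧ ‖y‖ < Real.exp j},
        ENNReal.ofReal (‖((ρ ((φ ∘ ψ) k)) • stPull (ρ ((φ ∘ ψ) k) ^ 2) (ρ ((φ ∘ ψ) k))
          (T ((φ ∘ ψ) k)) (x₀ ((φ ∘ ψ) k)) (u ((φ ∘ ψ) k))) 0 y‖ ^ 3) ≤ ENNReal.ofReal (q * j) := by
    intro j hj
    filter_upwards [eventually_ge_atTop j] with k hk
    exact zoom_annulus_budget (hdata ((φ ∘ ψ) k)).2.2.1 (hdata ((φ ∘ ψ) k)).2.2.2.2.2.2.2 j hj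
      (hk.trans (hφψ.id_le k))
  exact annulus_budget_of_weak hVc hgli.aestronglyMeasurable hg2 hgw' hq.le hbudget

end Summit.NavierStokesRegularity.NavierStokesRegularity.Cruxes.TypeIQuantSubcubicExp.AbRoot

end
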